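import Literature.NumberTheory.ComplexMultiplication.CMOrderPolynomialSuperficialElement
import Literature.NumberTheory.ComplexMultiplication.CMOrderPolynomialLocalizationLength
import Literature.NumberTheory.ComplexMultiplication.CMOrderSuperficialElements
import HarnessLib

/-!
# GREITHER 1982 THEOREM 2.1 `v(I) ≤ [S/mS : R/m]` at EVERY prime of an order, and MARSEGLIA 2024 LEMMA 4.3,
# COROLLARY 4.4, PROPOSITION 4.5 and THEOREM 4.7 without any residue-field or branching hypothesis

Family `hodge`, lane `lit-hodgefound` (Track 2 foundations library; seat p15, row g30-#3), topic
`Literature/NumberTheory/ComplexMultiplication`, namespaces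
`Literature.NumberTheory.ComplexMultiplication.EndOrder` (§2, the order `S = endOrder ρ` of a representation
`ρ : K →ₐ[ℚ] Matrix ι ι ℚ`) and `….CMTypeLattice` (§3, `S = endOrder (M_μ)` of a `ℚ`-basis `μ` of the number
field `K`); the maximal order is the idempotent `M` with `↑M = range (algebraMap (𝓞 K) K)`;
`gens_S(I) = Submodule.spanFinrank ↑I`; `dim_{S/𝔭} I/𝔭I` is `Module.finrank (S ⧸ 𝔭) (↥↑I ⧸ 𝔭 • ⊤)`.
THEOREMS ONLY: no definition, no instance, no notation, no named fact (net Literature debt `0`).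

## Sources, VERBATIM

C. Greither, *On the two generator problem for the ideals of a one-dimensional ring*, J. Pure Appl. Algebra
24 (1982) 265–276 [Greither1982TwoGenerator] (held `paper:doi-10-1016-0022-4049-82-90044-5`), p. 267:
"2.1. THEOREM. Let `R` be local. Then `v(R) = e(R)` (the multiplicity of `R`, see [5]) `= [S/mS : R/m]`
(minimal number of generators for the `R`-module `S`).  Proof. `e(R) = lim_{n→∞} [mⁿ/mⁿ⁺¹ : R/m] ≤ v(R)`.
Since `R` is Cohen-Macaulay, we also have `v(R) ≤ e(R)` by [5, p. 49]. […]"; p. 268: "2.2. COROLLARY. For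
`R` not necessarily local, we have `v(R) ≤ max(2, minimal number of generators of S as an R-module)`, and
if `v(R) ≠ 1` (i.e. `R` not a product of PID's), we have equality."

S. Marseglia, *Cohen-Macaulay type of orders, generators and ideal classes*, J. Algebra 658 (2024) 247–276
[Marseglia2024CMType] (arXiv:2206.03758), §4, p. 10: "It is known that, among all fractional `S`-ideals,
the one that requires the biggest number of generators is `𝒪_K`.  Lemma 4.3 ([Greither82]). Let `S` be an
order. Then `gens(S) ≤ max{2, gens_S(𝒪_K)}`. […] Corollary 4.4. Let `S` be a non-maximal order. Then
`gens(S) = gens_S(𝒪_K) = max{dim_{S/𝔭}(𝒪_K/𝔭𝒪_K) : 𝔭 prime of S}`. […] Proposition 4.5. […] In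
particular, if `S` is not maximal then `gens(S) = 1 + max{type(S + 𝔭𝒪_K) : 𝔭 a prime of S}`."; p. 11:
"Theorem 4.7. Let `S` be a non-maximal order, `𝒮` be the set of overorders `T` of `S`, and `d` be a
positive integer. Then the following are equivalent: (i) `1 + max_{T∈𝒮} type(T) = d`. […]
(iii) `gens_S(𝒪_K/S) = d − 1`. […] (vi) `gens(S) = d`."

K. Kiyek, J. L. Vicente, *Resolution of Curve and Surface Singularities* [KiyekVicente2004], Ch. II (3.1)
(«`ℓ_R(R/Rr) = ℓ_R(M/rM)`»), (4.18) proof (1) («the trick of adjoining an indeterminate …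
`R(X) := Σ⁻¹R[X]`»), App. B (10.4); PDF pp. 208, 231, 741.

## What is formalised, and how it deviates from the printed proofs

The tree proved GREITHER's local inequality `dim_{S/𝔭} I/𝔭I ≤ dim_{S/𝔭} 𝒪_K/𝔭𝒪_K` only at primes `𝔭`
carrying a superficial element INSIDE `S` — binary branching (`CMOrderIdealGeneratorsMaximalOrderBound`)
or at most `#(S/𝔭)` primes of `𝒪_K` above `𝔭` (`CMOrderSuperficialElements`) — because with a finite
residue field such an element need not exist.  The printed proof ([5, p. 49] = Sally, via `R(X)`) is
followed here literally: the superficial element is the polynomial `ξ ∈ 𝔭S[X]` of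
`CMOrderPolynomialSuperficialElement`, and the chain
`μ = ℓ_A(I[X]_P/𝔭I[X]_P) ≤ ℓ_A(I[X]_P/ξI[X]_P) = ℓ_A(𝒪_K[X]_P/ξ𝒪_K[X]_P) = ℓ_A(𝒪_K[X]_P/𝔭𝒪_K[X]_P) = n`
is computed with the length calculus of `CMOrderPolynomialLocalizationLength` over `A = S[X]_{𝔭S[X]}`,
the middle equality being KV II (3.1) through the sandwich `a𝒪_K ⊆ dI ⊆ 𝒪_K` (`a, d ∈ S ∖ 0`).  No
hypothesis on `𝔭` remains, so LEMMA 4.3, COROLLARY 4.4, PROPOSITION 4.5 «In particular» and THEOREM 4.7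
(i) ⟺ (iii) ⟺ (vi) hold for EVERY order `S = endOrder (M_μ)`, by the packaging already in the tree.

* **`EndOrder.finrank_quotient_smul_top_le`** (GREITHER THM. 2.1: `dim_{S/𝔭} I/𝔭I ≤ dim_{S/𝔭} 𝒪_K/𝔭𝒪_K`
  for every maximal `𝔭` and every `I ≠ 0`; the abstract-localisation form
  `EndOrder.finrank_quotient_smul_top_le_of_isLocalizedModule` is the proof, instantiated at
  `Localization.AtPrime (𝔭S[X])`).
* **`CMTypeLattice.spanFinrank_coe_le_max`** (LEMMA 4.3 `gens_S(I) ≤ max{2, gens_S(𝒪_K)}`, GREITHER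
  COR. 2.2).
* **`CMTypeLattice.iSup_spanFinrank_coe_eq_spanFinrank_coe`**,
  `CMTypeLattice.iSup_spanFinrank_coe_eq_iSup_finrank_quotient_smul_top` (COROLLARY 4.4
  `gens(S) = gens_S(𝒪_K) = max_𝔭 dim_{S/𝔭} 𝒪_K/𝔭𝒪_K`, `S ≠ 𝒪_K`).
* `CMTypeLattice.exists_not_isUnit_forall_iSup_add_one_eq_iSup_spanFinrank` (PROPOSITION 4.5 «In
  particular»).
* `CMTypeLattice.iSup_spanFinrank_coe_eq_spanFinrank_top_quotient_add_one` (THEOREM 4.7 (iii) ⟺ (vi)),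
  **`CMTypeLattice.forall_le_and_exists_eq_iSup_spanFinrank`** (THEOREM 4.7 (i) ⟺ (vi)).
-/

noncomputable section

open scoped nonZeroDivisors NumberField Polynomial
open NumberField Module FractionalIdeal Polynomial
open Submodule (traceDual)

namespace Literature.NumberTheory.ComplexMultiplication

/-! ## §1 Two pieces of plumbing -/

section Plumbing

/-- A subring of a field acts torsion-freely on the field. (Plumbing.) [folklore] -/
private theorem isTorsionFree_subring {F : Type*} [Field F] (S' : Subring F) : Module.IsTorsionFree S' F :=
  Module.IsTorsionFree.comap (S := F) (M := F) (fun x : S' ↦ (x : F))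
    (fun r hr ↦ IsRegular.of_ne_zero (by
      have h := hr.ne_zero
      exact_mod_cast h))
    (fun _ _ ↦ rfl)

/-- `r • y = C r • y` in the `R[X]`-module `PolynomialModule R V`. (Plumbing.) [folklore] -/
private theorem smul_eq_C_smul_aux {R' : Type*} [CommRing R'] {V : Type*} [AddCommGroup V] [Module R' V]
    (r : R') (y : PolynomialModule R' V) : r • y = (C r : R'[X]) • y := by
  rw [← Polynomial.algebraMap_eq, algebraMap_smul]

end Plumbing

/-! ## §2 GREITHER's local inequality at every prime -/

namespace EndOrder

section GreitherGeneral

variable {K : Type} [Field K] [NumberField K]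
variable {ι : Type} [Fintype ι] [DecidableEq ι] [Nonempty ι] {ρ : K →ₐ[ℚ] Matrix ι ι ℚ}

/-- **GREITHER 1982 THEOREM 2.1 through `R(X)`, for an arbitrary localisation datum of
`PolynomialModule S K` at `P = 𝔭S[X]`** (`A` any `IsLocalization.AtPrime A P`, `f` any
`IsLocalizedModule P.primeCompl f`): for the order `S = endOrder ρ`, the maximal order `M`, a maximal
ideal `𝔭` and `I ≠ 0`, `dim_{S/𝔭} I/𝔭I ≤ dim_{S/𝔭} 𝒪_K/𝔭𝒪_K`.  Proof as printed ([5, p. 49] via `R(X)`):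
with the superficial polynomial `ξ ∈ 𝔭[X]` and `s ∉ 𝔭[X]`, `s·𝔭𝒪_K[X] ⊆ ξ𝒪_K[X]`
(`exists_superficial_polynomial_map`),
`μ = ℓ_A(I[X]_P/𝔭I[X]_P) ≤ ℓ_A(I[X]_P/ξI[X]_P) = ℓ_A(𝒪_K[X]_P/ξ𝒪_K[X]_P) = ℓ_A(𝒪_K[X]_P/𝔭𝒪_K[X]_P) = n`,
the middle step by KV II (3.1) along `a𝒪_K ⊆ dI ⊆ 𝒪_K`. [cite: Greither1982TwoGenerator, §2 Thm. 2.1 and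
proof, p. 267] [cite: KiyekVicente2004, Ch. II (3.1), (4.18) proof (1), App. B (10.4), PDF pp. 208, 231,
741] [cite: Marseglia2024CMType, §4 Lemma 4.3, p. 10] -/
theorem finrank_quotient_smul_top_le_of_isLocalizedModule {M : FractionalIdeal (endOrder ρ)⁰ K}
    (hMO : (M : Set K) = (algebraMap (𝓞 K) K).range) {𝔭 : Ideal (endOrder ρ)} [h𝔭 : 𝔭.IsMaximal]
    {I : FractionalIdeal (endOrder ρ)⁰ K} (hI : I ≠ 0)
    (A : Type*) [CommRing A] [Algebra (endOrder ρ)[X] A]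
    [IsLocalization.AtPrime A (𝔭.map (C : endOrder ρ →+* (endOrder ρ)[X]))]
    {N' : Type*} [AddCommGroup N'] [Module (endOrder ρ)[X] N'] [Module A N']
    [IsScalarTower (endOrder ρ)[X] A N'] (f : PolynomialModule (endOrder ρ) K →ₗ[(endOrder ρ)[X]] N')
    [IsLocalizedModule (𝔭.map (C : endOrder ρ →+* (endOrder ρ)[X])).primeCompl f] :
    Module.finrank (endOrder ρ ⧸ 𝔭)
        (↥(I : Submodule (endOrder ρ) K) ⧸ (𝔭 • ⊤ : Submodule (endOrder ρ) (I : Submodule (endOrder ρ) K))) ≤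
      Module.finrank (endOrder ρ ⧸ 𝔭)
        (↥(M : Submodule (endOrder ρ) K) ⧸ (𝔭 • ⊤ : Submodule (endOrder ρ) (M : Submodule (endOrder ρ) K))) := by
  classical
  haveI := CMTypeLattice.isNoetherianRing_endOrder ρ
  haveI : Module.IsTorsionFree (endOrder ρ) K := isTorsionFree_subring _
  have h0 : 𝔭 ≠ ⊥ := Ring.ne_bot_of_isMaximal_of_not_isField h𝔭 EndOrder.not_isField
  have hI0 : (I : Submodule (endOrder ρ) K) ≠ ⊥ := fun h ↦ hI (FractionalIdeal.coeToSubmodule_eq_bot.1 h)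
  obtain ⟨-, h1M⟩ := EndOrder.mul_self_le_and_one_mem_of_coe_eq_range hMO
  have mono :=
    (Submodule.localized'gi A (𝔭.map (C : endOrder ρ →+* (endOrder ρ)[X])).primeCompl f).gc.monotone_l
  -- the lattices
  set LI : Submodule (endOrder ρ) K := (I : Submodule (endOrder ρ) K) with hLI
  set LM : Submodule (endOrder ρ) K := (M : Submodule (endOrder ρ) K) with hLM
  haveI hfinI : Module.Finite (endOrder ρ) ↥LI :=
    Module.Finite.iff_fg.2 (FractionalIdeal.fg_of_isNoetherianRing le_rfl I)
  haveI hfinM : Module.Finite (endOrder ρ) ↥LM :=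
    Module.Finite.iff_fg.2 (FractionalIdeal.fg_of_isNoetherianRing le_rfl M)
  -- STEP 1: the superficial polynomial `ξ ∈ 𝔭[X]`, `s ∉ 𝔭[X]`
  obtain ⟨ξ, hξP, s, hsP, Hsup⟩ := exists_superficial_polynomial_map (ρ := ρ) hMO (𝔭 := 𝔭)
  have hξ0 : ξ ≠ 0 := by
    rintro rfl
    obtain ⟨p, hp, hp0⟩ := Submodule.exists_mem_ne_zero_of_ne_bot h0
    obtain ⟨h, -, hh⟩ := Hsup p hp 1 h1M
    rw [Polynomial.map_zero, zero_mul, map_one, mul_one,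
      Polynomial.map_eq_zero_iff (FaithfulSMul.algebraMap_injective (endOrder ρ) K)] at hh
    rcases mul_eq_zero.1 hh with hs | hCp
    · exact hsP (hs ▸ Ideal.zero_mem _)
    · exact hp0 (Polynomial.C_eq_zero.1 hCp)
  set φ : PolynomialModule (endOrder ρ) K →ₗ[(endOrder ρ)[X]] PolynomialModule (endOrder ρ) K :=
    LinearMap.lsmul (endOrder ρ)[X] (PolynomialModule (endOrder ρ) K) ξ with hφdef
  have hφ : Function.Injective φ := NumberRing.lsmul_injective_of_ne_zero hξ0
  have hφle : ∀ W : Submodule (endOrder ρ)[X] (PolynomialModule (endOrder ρ) K), W.map φ ≤ W := fun W ↦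
    Submodule.map_le_iff_le_comap.2 fun w hw ↦ W.smul_mem ξ hw
  have hφP : ∀ W : Submodule (endOrder ρ)[X] (PolynomialModule (endOrder ρ) K),
      W.map φ ≤ (𝔭.map (C : endOrder ρ →+* (endOrder ρ)[X])) • W := fun W ↦
    Submodule.map_le_iff_le_comap.2 fun w hw ↦ Submodule.smul_mem_smul hξP hw
  -- STEP 2: `s · 𝔭M[X] ⊆ ξ · M[X]`, element by element
  have hMside : ∀ x ∈ (𝔭.map (C : endOrder ρ →+* (endOrder ρ)[X])) •
      Submodule.span (endOrder ρ)[X] (PolynomialModule.single (endOrder ρ) 0 '' (LM : Set K)),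
      s • x ∈ (Submodule.span (endOrder ρ)[X] (PolynomialModule.single (endOrder ρ) 0 '' (LM : Set K))).map φ := by
    intro x hx
    rw [← NumberRing.smul_polySpan] at hx
    have key : Submodule.span (endOrder ρ)[X]
          (PolynomialModule.single (endOrder ρ) 0 '' ((𝔭 • LM : Submodule (endOrder ρ) K) : Set K)) ≤
        ((Submodule.span (endOrder ρ)[X] (PolynomialModule.single (endOrder ρ) 0 '' (LM : Set K))).map φ).comap
          (LinearMap.lsmul (endOrder ρ)[X] (PolynomialModule (endOrder ρ) K) s) := by
      refine Submodule.span_le.2 ?_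
      rintro _ ⟨v, hv, rfl⟩
      refine Submodule.smul_induction_on hv (fun p hp m hm ↦ ?_) (fun x y hx hy ↦ ?_)
      · obtain ⟨h, hhM, hh⟩ := Hsup p hp m hm
        rw [SetLike.mem_coe, Submodule.mem_comap, LinearMap.lsmul_apply, Submodule.mem_map]
        refine ⟨PolynomialModule.equivPolynomial.symm h, ?_, ?_⟩
        · rw [NumberRing.mem_polySpan_iff]
          intro n
          rw [← NumberRing.coeff_equivPolynomial_apply, LinearEquiv.apply_symm_apply]
          exact hhM n
        · rw [hφdef, LinearMap.lsmul_apply]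
          apply PolynomialModule.equivPolynomial.injective
          rw [NumberRing.equivPolynomial_smul, LinearEquiv.apply_symm_apply, PolynomialModule.single_smul,
            smul_eq_C_smul_aux p, smul_smul, NumberRing.equivPolynomial_smul,
            PolynomialModule.equivPolynomial_single, Polynomial.monomial_zero_left]
          exact hh.symm
      · rw [SetLike.mem_coe, PolynomialModule.single_add]
        exact Submodule.add_mem _ hx hy
    exact key hx
  -- STEP 3: hence `(ξM[X])_P = (𝔭M[X])_P`
  have hlocM : ((𝔭.map (C : endOrder ρ →+* (endOrder ρ)[X])) •
        Submodule.span (endOrder ρ)[X] (PolynomialModule.single (endOrder ρ) 0 '' (LM : Set K))).localized' A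
        (𝔭.map (C : endOrder ρ →+* (endOrder ρ)[X])).primeCompl f =
      ((Submodule.span (endOrder ρ)[X] (PolynomialModule.single (endOrder ρ) 0 '' (LM : Set K))).map φ).localized'
        A (𝔭.map (C : endOrder ρ →+* (endOrder ρ)[X])).primeCompl f :=
    le_antisymm (NumberRing.localized'_le_localized'_of_forall_smul_mem _ A f hsP hMside) (mono (hφP _))
  -- STEP 4: `n = dim 𝒪_K/𝔭𝒪_K = ℓ_A(M[X]_P/ξM[X]_P)`
  have hn := NumberRing.length_localized_polySpan_smul_eq_finrank 𝔭 A f LM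
  rw [NumberRing.smul_polySpan, hlocM] at hn
  -- STEP 5: `μ = dim I/𝔭I ≤ ℓ_A(I[X]_P/ξI[X]_P)`
  have hμ := NumberRing.length_localized_polySpan_smul_eq_finrank 𝔭 A f LI
  rw [NumberRing.smul_polySpan] at hμ
  have hμ' := NumberRing.length_subquotient_anti_left (A := A)
    (mono (hφP (Submodule.span (endOrder ρ)[X] (PolynomialModule.single (endOrder ρ) 0 '' (LI : Set K)))))
    (mono (Submodule.smul_le_right (I := 𝔭.map (C : endOrder ρ →+* (endOrder ρ)[X]))
      (N := Submodule.span (endOrder ρ)[X] (PolynomialModule.single (endOrder ρ) 0 '' (LI : Set K)))))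
  rw [hμ] at hμ'
  -- STEP 6: the sandwich `aM ⊆ dI ⊆ M` with `a, d ∈ S ∖ 0`
  obtain ⟨d, hdS, hdI⟩ := I.isFractional
  obtain ⟨z, hzI, hz0⟩ := Submodule.exists_mem_ne_zero_of_ne_bot hI0
  obtain ⟨y₀, hy₀⟩ := hdI z hzI
  obtain ⟨d', hd'S, hd'M⟩ := M.isFractional
  have hd0 : d ≠ 0 := nonZeroDivisors.ne_zero hdS
  have hy₀0 : y₀ ≠ 0 := by
    rintro rfl
    rw [map_zero, eq_comm, smul_eq_zero] at hy₀
    rcases hy₀ with h | h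
    exacts [hd0 h, hz0 h]
  set a : endOrder ρ := d' * y₀ with hadef
  have ha0 : a ≠ 0 := mul_ne_zero (nonZeroDivisors.ne_zero hd'S) hy₀0
  have hdIM : (Ideal.span {d} : Ideal (endOrder ρ)) • LI ≤ LM := by
    refine Submodule.smul_le.2 fun r hr x hx ↦ ?_
    obtain ⟨c, rfl⟩ := Ideal.mem_span_singleton'.1 hr
    obtain ⟨y, hy⟩ := hdI x hx
    rw [mul_smul, ← hy, Algebra.algebraMap_eq_smul_one, smul_smul]
    exact LM.smul_mem _ h1M
  have haM : (Ideal.span {a} : Ideal (endOrder ρ)) • LM ≤ (Ideal.span {d} : Ideal (endOrder ρ)) • LI := by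
    refine Submodule.smul_le.2 fun r hr m hm ↦ ?_
    obtain ⟨c, rfl⟩ := Ideal.mem_span_singleton'.1 hr
    obtain ⟨m₀, hm₀⟩ := hd'M m hm
    have e : (c * a) • m = c • (d • (m₀ • z)) := by
      rw [hadef, mul_comm d' y₀, mul_smul, mul_smul, ← hm₀, Algebra.smul_def y₀ (algebraMap (endOrder ρ) K m₀),
        mul_comm (algebraMap (endOrder ρ) K y₀) _, ← Algebra.smul_def m₀ (algebraMap (endOrder ρ) K y₀), hy₀,
        smul_comm m₀ d z]
    rw [e]
    exact Submodule.smul_mem _ c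
      (Submodule.smul_mem_smul (Ideal.mem_span_singleton_self d) (LI.smul_mem m₀ hzI))
  -- STEP 7: finiteness `ℓ_A(M[X]_P/(dI)[X]_P) < ∞` (through `aM ⊆ dI` and `𝔭ᵗ ⊆ 𝔭ᵗ⁺¹ + aS`)
  haveI : Finite (endOrder ρ ⧸ (Ideal.span {a} : Ideal (endOrder ρ))) :=
    CMTypeLattice.finite_quotient_endOrder ρ (by
      rw [ne_eq, Ideal.span_singleton_eq_bot]
      exact ha0)
  obtain ⟨t, ht⟩ := NumberRing.exists_pow_le_pow_succ_sup 𝔭 (Ideal.span {a} : Ideal (endOrder ρ))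
  have hfinM := NumberRing.length_localized_polySpan_ne_top_of_pow_le 𝔭 A f (V := K) (M := LM)
    (FractionalIdeal.fg_of_isNoetherianRing le_rfl M) ht
  set ψ : PolynomialModule (endOrder ρ) K →ₗ[(endOrder ρ)[X]] PolynomialModule (endOrder ρ) K :=
    LinearMap.lsmul (endOrder ρ)[X] (PolynomialModule (endOrder ρ) K) (C d) with hψdef
  have hψ : Function.Injective ψ := NumberRing.lsmul_injective_of_ne_zero (Polynomial.C_ne_zero.2 hd0)
  have hW₁ : Submodule.span (endOrder ρ)[X] (PolynomialModule.single (endOrder ρ) 0 ''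
        (((Ideal.span {d} : Ideal (endOrder ρ)) • LI : Submodule (endOrder ρ) K) : Set K)) =
      (Submodule.span (endOrder ρ)[X] (PolynomialModule.single (endOrder ρ) 0 '' (LI : Set K))).map ψ := by
    rw [NumberRing.smul_polySpan, Ideal.map_span, Set.image_singleton,
      NumberRing.span_singleton_smul_eq_map_lsmul]
  have h12 : (Submodule.span (endOrder ρ)[X] (PolynomialModule.single (endOrder ρ) 0 '' (LI : Set K))).map ψ ≤
      Submodule.span (endOrder ρ)[X] (PolynomialModule.single (endOrder ρ) 0 '' (LM : Set K)) :=
    hW₁ ▸ NumberRing.polySpan_mono hdIM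
  have hfin₁ := ne_top_of_le_ne_top hfinM (NumberRing.length_subquotient_anti_left
    (mono (NumberRing.polySpan_mono haM)) (mono (NumberRing.polySpan_mono hdIM)))
  rw [hW₁] at hfin₁
  -- STEP 8: KV II (3.1) `ℓ_A((dI)[X]_P/ξ(dI)[X]_P) = ℓ_A(M[X]_P/ξM[X]_P)` and the scaling by `d`
  have hidx := NumberRing.length_localized'_quotient_map_eq_of_ne_top
    (𝔭.map (C : endOrder ρ →+* (endOrder ρ)[X])).primeCompl A f φ hφ h12 (hφle _) (hφle _) hfin₁
  have hcomm :
      ((Submodule.span (endOrder ρ)[X] (PolynomialModule.single (endOrder ρ) 0 '' (LI : Set K))).map φ).map ψ =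
      ((Submodule.span (endOrder ρ)[X] (PolynomialModule.single (endOrder ρ) 0 '' (LI : Set K))).map ψ).map φ := by
    rw [← Submodule.map_comp, ← Submodule.map_comp]
    congr 1
    refine LinearMap.ext fun x ↦ ?_
    rw [LinearMap.comp_apply, LinearMap.comp_apply, hφdef, hψdef, LinearMap.lsmul_apply, LinearMap.lsmul_apply,
      LinearMap.lsmul_apply, LinearMap.lsmul_apply]
    exact smul_comm _ _ _
  have hscale := NumberRing.length_localized'_map_eq (𝔭.map (C : endOrder ρ →+* (endOrder ρ)[X])).primeCompl
    A f ψ hψ ((Submodule.span (endOrder ρ)[X] (PolynomialModule.single (endOrder ρ) 0 '' (LI : Set K))).map φ)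
    (Submodule.span (endOrder ρ)[X] (PolynomialModule.single (endOrder ρ) 0 '' (LI : Set K)))
  rw [hcomm] at hscale
  have key := hμ'.trans_eq (hscale.symm.trans (hidx.trans hn))
  exact_mod_cast key

/-- **GREITHER 1982 THEOREM 2.1 «`v(R) = e(R) = [S/mS : R/m]`», the inequality `v(I) ≤ [S/mS : R/m]`, AT
EVERY MAXIMAL IDEAL OF EVERY ORDER: for `S = endOrder ρ`, the maximal order `M` (`↑M = 𝒪_K`), a maximal
ideal `𝔭` of `S` and a fractional ideal `I ≠ 0`, `dim_{S/𝔭} I/𝔭I ≤ dim_{S/𝔭} 𝒪_K/𝔭𝒪_K`** — no hypothesis on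
the residue field or on the primes of `𝒪_K` above `𝔭` (compare
`CMTypeLattice.finrank_quotient_smul_top_le_of_superficial`, `…_of_binaryBranching`, `…_of_card_le`).  This
is MARSEGLIA's «among all fractional `S`-ideals, the one that requires the biggest number of generators is
`𝒪_K`», locally. [cite: Greither1982TwoGenerator, §2 Thm. 2.1, p. 267] [cite: Marseglia2024CMType, §4
Lemma 4.3 ([Greither82]), p. 10] [cite: KiyekVicente2004, Ch. II (4.18) proof (1), PDF p. 231] -/
theorem finrank_quotient_smul_top_le {M : FractionalIdeal (endOrder ρ)⁰ K}
    (hMO : (M : Set K) = (algebraMap (𝓞 K) K).range) {𝔭 : Ideal (endOrder ρ)} [h𝔭 : 𝔭.IsMaximal]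
    {I : FractionalIdeal (endOrder ρ)⁰ K} (hI : I ≠ 0) :
    Module.finrank (endOrder ρ ⧸ 𝔭)
        (↥(I : Submodule (endOrder ρ) K) ⧸ (𝔭 • ⊤ : Submodule (endOrder ρ) (I : Submodule (endOrder ρ) K))) ≤
      Module.finrank (endOrder ρ ⧸ 𝔭)
        (↥(M : Submodule (endOrder ρ) K) ⧸ (𝔭 • ⊤ : Submodule (endOrder ρ) (M : Submodule (endOrder ρ) K))) :=
  finrank_quotient_smul_top_le_of_isLocalizedModule hMO hI
    (Localization.AtPrime (𝔭.map (C : endOrder ρ →+* (endOrder ρ)[X])))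
    (LocalizedModule.mkLinearMap (𝔭.map (C : endOrder ρ →+* (endOrder ρ)[X])).primeCompl
      (PolynomialModule (endOrder ρ) K))

end GreitherGeneral

end EndOrder

/-! ## §3 LEMMA 4.3, COROLLARY 4.4, PROPOSITION 4.5 and THEOREM 4.7 for every order -/

namespace CMTypeLattice

section Consequences

variable {K : Type} [Field K] [NumberField K]
variable {ι : Type} [Fintype ι] [DecidableEq ι] (μ : Basis ι ℚ K) [Nonempty ι]
variable [IsFractionRing (endOrder (Algebra.leftMulMatrix μ)) K]

/-- **MARSEGLIA 2024 LEMMA 4.3 ([Greither82]) «`gens(S) ≤ max{2, gens_S(𝒪_K)}`», ideal by ideal, for EVERY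
order: `gens_S(I) ≤ max{2, gens_S(𝒪_K)}` for every fractional ideal `I ≠ 0`** (GREITHER COR. 2.2;
Forster–Swan through the tree's `EndOrder.spanFinrank_le_of_forall_finrank_quotient_le`, the invertible
primes contributing `1` and the others `dim 𝒪_K/𝔭𝒪_K ≤ gens_S(𝒪_K)` by
`EndOrder.finrank_quotient_smul_top_le`). [cite: Marseglia2024CMType, §4 Lemma 4.3, p. 10]
[cite: Greither1982TwoGenerator, §2 Cor. 2.2, p. 268] -/
theorem spanFinrank_coe_le_max {M : FractionalIdeal (endOrder (Algebra.leftMulMatrix μ))⁰ K}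
    (hMO : (M : Set K) = (algebraMap (𝓞 K) K).range)
    {I : FractionalIdeal (endOrder (Algebra.leftMulMatrix μ))⁰ K} (hI : I ≠ 0) :
    (I : Submodule (endOrder (Algebra.leftMulMatrix μ)) K).spanFinrank ≤
      max 2 (M : Submodule (endOrder (Algebra.leftMulMatrix μ)) K).spanFinrank := by
  obtain ⟨n, hn⟩ : ∃ n, max 2 (M : Submodule (endOrder (Algebra.leftMulMatrix μ)) K).spanFinrank = n + 1 + 1 :=
    ⟨max 2 (M : Submodule (endOrder (Algebra.leftMulMatrix μ)) K).spanFinrank - 2, by omega⟩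
  rw [hn]
  refine EndOrder.spanFinrank_le_of_forall_finrank_quotient_le hI (by omega) fun 𝔭 ↦ ?_
  haveI := 𝔭.isMaximal
  rw [← hn]
  by_cases hu : IsUnit (𝔭.asIdeal : FractionalIdeal (endOrder (Algebra.leftMulMatrix μ))⁰ K)
  · rw [EndOrder.finrank_quotient_eq_one_of_isUnit_coeIdeal (asIdeal_ne_bot μ 𝔭) hu hI]
    exact le_max_of_le_left one_le_two
  · exact (EndOrder.finrank_quotient_smul_top_le hMO hI).trans
      (le_max_of_le_right (EndOrder.finrank_quotient_smul_top_le_spanFinrank M (asIdeal_ne_bot μ 𝔭)))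

/-- **MARSEGLIA 2024 COROLLARY 4.4 «`gens(S) = gens_S(𝒪_K)`» for EVERY non-maximal order** (GREITHER
COR. 2.2, equality case). [cite: Marseglia2024CMType, §4 Cor. 4.4, p. 10] [cite: Greither1982TwoGenerator,
§2 Cor. 2.2, p. 268] -/
theorem iSup_spanFinrank_coe_eq_spanFinrank_coe {M : FractionalIdeal (endOrder (Algebra.leftMulMatrix μ))⁰ K}
    (hMO : (M : Set K) = (algebraMap (𝓞 K) K).range)
    (hS : ∃ a : 𝓞 K, (a : K) ∉ endOrder (Algebra.leftMulMatrix μ)) :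
    ⨆ I : {I : FractionalIdeal (endOrder (Algebra.leftMulMatrix μ))⁰ K // I ≠ 0},
        ((I : FractionalIdeal (endOrder (Algebra.leftMulMatrix μ))⁰ K) :
          Submodule (endOrder (Algebra.leftMulMatrix μ)) K).spanFinrank =
      (M : Submodule (endOrder (Algebra.leftMulMatrix μ)) K).spanFinrank := by
  have h2 := two_le_spanFinrank_coe_of_exists_not_mem μ hMO hS
  have hM0 := ne_zero_of_coe_eq_range μ hMO
  haveI : Nonempty {I : FractionalIdeal (endOrder (Algebra.leftMulMatrix μ))⁰ K // I ≠ 0} := ⟨⟨M, hM0⟩⟩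
  refine le_antisymm (ciSup_le fun I ↦ ?_) (spanFinrank_coe_le_iSup μ hM0)
  exact (spanFinrank_coe_le_max μ hMO I.2).trans (max_le h2 le_rfl)

/-- **COROLLARY 4.4 in full for EVERY non-maximal order: `gens(S) = gens_S(𝒪_K) = max_𝔭 dim_{S/𝔭} 𝒪_K/𝔭𝒪_K`.**
[cite: Marseglia2024CMType, §4 Cor. 4.4, p. 10] -/
theorem iSup_spanFinrank_coe_eq_iSup_finrank_quotient_smul_top
    {M : FractionalIdeal (endOrder (Algebra.leftMulMatrix μ))⁰ K}
    (hMO : (M : Set K) = (algebraMap (𝓞 K) K).range)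
    (hS : ∃ a : 𝓞 K, (a : K) ∉ endOrder (Algebra.leftMulMatrix μ)) :
    ⨆ I : {I : FractionalIdeal (endOrder (Algebra.leftMulMatrix μ))⁰ K // I ≠ 0},
        ((I : FractionalIdeal (endOrder (Algebra.leftMulMatrix μ))⁰ K) :
          Submodule (endOrder (Algebra.leftMulMatrix μ)) K).spanFinrank =
      ⨆ 𝔭 : MaximalSpectrum (endOrder (Algebra.leftMulMatrix μ)),
        Module.finrank (endOrder (Algebra.leftMulMatrix μ) ⧸ 𝔭.asIdeal)
          (↥(M : Submodule (endOrder (Algebra.leftMulMatrix μ)) K) ⧸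
            (𝔭.asIdeal • ⊤ : Submodule (endOrder (Algebra.leftMulMatrix μ))
              (M : Submodule (endOrder (Algebra.leftMulMatrix μ)) K))) := by
  rw [iSup_spanFinrank_coe_eq_spanFinrank_coe μ hMO hS, spanFinrank_coe_eq_iSup_finrank_quotient_smul_top μ hMO hS]

/-- **MARSEGLIA 2024 PROPOSITION 4.5 «In particular, if `S` is not maximal then
`gens(S) = 1 + max{type(S + 𝔭𝒪_K) : 𝔭 a prime of S}`» for EVERY non-maximal order**: a non-invertible prime
`𝔭` with `type(T) + 1 = gens(S)` for every presentation `T = endOrder (M_ν)` of `S + 𝔭𝒪_K`.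
[cite: Marseglia2024CMType, §4 Prop. 4.5 («In particular») and Cor. 4.4, p. 10] -/
theorem exists_not_isUnit_forall_iSup_add_one_eq_iSup_spanFinrank
    {M : FractionalIdeal (endOrder (Algebra.leftMulMatrix μ))⁰ K}
    (hMO : (M : Set K) = (algebraMap (𝓞 K) K).range)
    (hS : ∃ a : 𝓞 K, (a : K) ∉ endOrder (Algebra.leftMulMatrix μ)) :
    ∃ 𝔭 : MaximalSpectrum (endOrder (Algebra.leftMulMatrix μ)),
      ¬ IsUnit (𝔭.asIdeal : FractionalIdeal (endOrder (Algebra.leftMulMatrix μ))⁰ K) ∧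
      ∀ ν : Basis ι ℚ K, (∀ x : K, x ∈ endOrder (Algebra.leftMulMatrix ν) ↔
          ∃ s ∈ endOrder (Algebra.leftMulMatrix μ),
            ∃ y ∈ (𝔭.asIdeal : FractionalIdeal (endOrder (Algebra.leftMulMatrix μ))⁰ K) * M, x = s + y) →
        ∀ T' : FractionalIdeal (endOrder (Algebra.leftMulMatrix ν))⁰ K,
          (T' : Submodule (endOrder (Algebra.leftMulMatrix ν)) K) =
            traceDual ℤ ℚ ((1 : FractionalIdeal (endOrder (Algebra.leftMulMatrix ν))⁰ K) :
              Submodule (endOrder (Algebra.leftMulMatrix ν)) K) →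
          (⨆ 𝔔 : MaximalSpectrum (endOrder (Algebra.leftMulMatrix ν)),
              Module.finrank (endOrder (Algebra.leftMulMatrix ν) ⧸ 𝔔.asIdeal)
                ((T' : Submodule (endOrder (Algebra.leftMulMatrix ν)) K) ⧸
                  (𝔔.asIdeal • ⊤ : Submodule (endOrder (Algebra.leftMulMatrix ν))
                    (T' : Submodule (endOrder (Algebra.leftMulMatrix ν)) K)))) + 1 =
            ⨆ I : {I : FractionalIdeal (endOrder (Algebra.leftMulMatrix μ))⁰ K // I ≠ 0},
              ((I : FractionalIdeal (endOrder (Algebra.leftMulMatrix μ))⁰ K) :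
                Submodule (endOrder (Algebra.leftMulMatrix μ)) K).spanFinrank := by
  rw [iSup_spanFinrank_coe_eq_spanFinrank_coe μ hMO hS]
  exact exists_not_isUnit_forall_iSup_add_one_eq_spanFinrank_coe μ hMO hS

/-- **MARSEGLIA 2024 THEOREM 4.7, (iii) ⟺ (vi) «`gens_S(𝒪_K/S) = d − 1` ⟺ `gens(S) = d`» for EVERY
non-maximal order: `gens(S) = gens_S(𝒪_K/S) + 1`.** [cite: Marseglia2024CMType, §4 Thm. 4.7 ((iii) ⟺ (vi)),
p. 11] -/
theorem iSup_spanFinrank_coe_eq_spanFinrank_top_quotient_add_one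
    {M : FractionalIdeal (endOrder (Algebra.leftMulMatrix μ))⁰ K}
    (hMO : (M : Set K) = (algebraMap (𝓞 K) K).range)
    (hS : ∃ a : 𝓞 K, (a : K) ∉ endOrder (Algebra.leftMulMatrix μ)) :
    ⨆ I : {I : FractionalIdeal (endOrder (Algebra.leftMulMatrix μ))⁰ K // I ≠ 0},
        ((I : FractionalIdeal (endOrder (Algebra.leftMulMatrix μ))⁰ K) :
          Submodule (endOrder (Algebra.leftMulMatrix μ)) K).spanFinrank =
      (⊤ : Submodule (endOrder (Algebra.leftMulMatrix μ))
          ((M : Submodule (endOrder (Algebra.leftMulMatrix μ)) K) ⧸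
            (1 : Submodule (endOrder (Algebra.leftMulMatrix μ)) K).comap
              (M : Submodule (endOrder (Algebra.leftMulMatrix μ)) K).subtype)).spanFinrank + 1 := by
  rw [iSup_spanFinrank_coe_eq_spanFinrank_coe μ hMO hS, spanFinrank_top_quotient_add_one_eq_spanFinrank_coe μ hMO hS]

/-- **MARSEGLIA 2024 THEOREM 4.7, (i) ⟺ (vi) «`1 + max_{T ∈ 𝒮} type(T) = d` ⟺ `gens(S) = d`» for EVERY
non-maximal order** (`type(T) + 1 ≤ gens(S)` for every over-order `T = endOrder (M_ν) ⊇ S` in its canonical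
presentation, with `=` for some `T = S + 𝔭𝒪_K`). [cite: Marseglia2024CMType, §4 Thm. 4.7 ((i) ⟺ (vi)),
p. 11] -/
theorem forall_le_and_exists_eq_iSup_spanFinrank {M : FractionalIdeal (endOrder (Algebra.leftMulMatrix μ))⁰ K}
    (hMO : (M : Set K) = (algebraMap (𝓞 K) K).range)
    (hS : ∃ a : 𝓞 K, (a : K) ∉ endOrder (Algebra.leftMulMatrix μ)) :
    (∀ ν : Basis ι ℚ K, endOrder (Algebra.leftMulMatrix μ) ≤ endOrder (Algebra.leftMulMatrix ν) →
      ∀ T' : FractionalIdeal (endOrder (Algebra.leftMulMatrix ν))⁰ K,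
        (T' : Submodule (endOrder (Algebra.leftMulMatrix ν)) K) =
          traceDual ℤ ℚ ((1 : FractionalIdeal (endOrder (Algebra.leftMulMatrix ν))⁰ K) :
            Submodule (endOrder (Algebra.leftMulMatrix ν)) K) →
        (⨆ 𝔔 : MaximalSpectrum (endOrder (Algebra.leftMulMatrix ν)),
            Module.finrank (endOrder (Algebra.leftMulMatrix ν) ⧸ 𝔔.asIdeal)
              ((T' : Submodule (endOrder (Algebra.leftMulMatrix ν)) K) ⧸
                (𝔔.asIdeal • ⊤ : Submodule (endOrder (Algebra.leftMulMatrix ν))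
                  (T' : Submodule (endOrder (Algebra.leftMulMatrix ν)) K)))) + 1 ≤
          ⨆ I : {I : FractionalIdeal (endOrder (Algebra.leftMulMatrix μ))⁰ K // I ≠ 0},
            ((I : FractionalIdeal (endOrder (Algebra.leftMulMatrix μ))⁰ K) :
              Submodule (endOrder (Algebra.leftMulMatrix μ)) K).spanFinrank) ∧
    ∃ ν : Basis ι ℚ K, endOrder (Algebra.leftMulMatrix μ) ≤ endOrder (Algebra.leftMulMatrix ν) ∧
      ∀ T' : FractionalIdeal (endOrder (Algebra.leftMulMatrix ν))⁰ K,
        (T' : Submodule (endOrder (Algebra.leftMulMatrix ν)) K) =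
          traceDual ℤ ℚ ((1 : FractionalIdeal (endOrder (Algebra.leftMulMatrix ν))⁰ K) :
            Submodule (endOrder (Algebra.leftMulMatrix ν)) K) →
        (⨆ 𝔔 : MaximalSpectrum (endOrder (Algebra.leftMulMatrix ν)),
            Module.finrank (endOrder (Algebra.leftMulMatrix ν) ⧸ 𝔔.asIdeal)
              ((T' : Submodule (endOrder (Algebra.leftMulMatrix ν)) K) ⧸
                (𝔔.asIdeal • ⊤ : Submodule (endOrder (Algebra.leftMulMatrix ν))
                  (T' : Submodule (endOrder (Algebra.leftMulMatrix ν)) K)))) + 1 =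
          ⨆ I : {I : FractionalIdeal (endOrder (Algebra.leftMulMatrix μ))⁰ K // I ≠ 0},
            ((I : FractionalIdeal (endOrder (Algebra.leftMulMatrix μ))⁰ K) :
              Submodule (endOrder (Algebra.leftMulMatrix μ)) K).spanFinrank := by
  refine ⟨fun ν hST T' hT' ↦ ?_, ?_⟩
  · haveI := isFractionRing_endOrder (Algebra.leftMulMatrix ν)
    exact iSup_finrank_traceDual_quotient_add_one_le_iSup_spanFinrank_of_le μ hS hST hT'
  · obtain ⟨𝔭, -, h𝔭⟩ := exists_not_isUnit_forall_iSup_add_one_eq_iSup_spanFinrank μ hMO hS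
    obtain ⟨ν, hν⟩ := exists_basis_mem_endOrder_iff_exists_add μ hMO 𝔭.asIdeal
    exact ⟨ν, endOrder_le_endOrder_of_mem_iff μ ν hν, h𝔭 ν hν⟩

end Consequences

end CMTypeLattice

end Literature.NumberTheory.ComplexMultiplication
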